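import Literature.Analysis.SpecialFunctions.HypergeometricPolynomialBounds
import Mathlib.Analysis.Calculus.SmoothSeries
import Mathlib.Analysis.SpecificLimits.Normed
import HarnessLib

/-!
# The Jacobi heat series `Σ γ_n e^{-μ n(n+1) t} y_n(z)`

Topic `Literature/Analysis/SpecialFunctions` (generic). Sequel of
`HypergeometricPolynomialBounds.lean`; motivation: the explicit solution of LSW's boundary problem
behind `Literature.Probability.Percolation.LawlerSchrammWerner2002_hittingPDE` (LSW (2002),
Lemma 2.2: "The theory of diffusion processes … imply that `h(θ, t)` is smooth"). For `1 < c < 2`,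
`μ > 0` and coefficients `γ_n` with `γ_n² h_n ≤ G` (`h_n = ∫₀¹ ρ y_n²`; this is what Bessel's
inequality gives for `γ_n = ⟨f, y_n⟩_ρ / h_n`, `f ∈ L²(ρ)`), the series

  `Y(z, t) = Σ_n γ_n e^{-μ n(n+1) t} y_n(z)`,   `y_n = ₂F₁(-n, n+1; c; ·)`,

converges for `t > 0`, `z ∈ (0, 1]`, together with its `z`-, `zz`- and `t`-derivatives
(termwise; the terms are `O((n+1)³ e^{-μ n t₀})` on `[a, 1) × [t₀, ∞)` by the bounds of the
previous file), all of these are continuous, and `Y` solves the **Jacobi heat equation**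

  `∂ₜ Y = μ [z(1-z) ∂²_z Y + (c - 2z) ∂_z Y]`  on `(0, 1) × (0, ∞)`

(Euler's equation `z(1-z) y_n'' + (c-2z) y_n' = -n(n+1) y_n` termwise). Near `z = 0`,
`|Y(z, t)| ≤ C z^{(1-c)/2}`; `Y(·, t)` is continuous up to `z = 1` and `∂_z Y` is bounded up to
`z = 1`. No named fact is introduced.

## Contents

* `jacobiHeatTerm`, `jacobiHeat`, `jacobiHeatDz`, `jacobiHeatDzz`, `jacobiHeatDt` (definitions);
* `summable_pow_mul_geometric'` (`Σ (n+1)^p r^n`), termwise bounds;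
* `continuousOn_jacobiHeat` (on `[a, 1] × [t₀, ∞)`) and `continuousOn_jacobiHeat'` (on
  `(0, 1] × (0, ∞)`), `hasDerivAt_jacobiHeat_z`, `hasDerivAt_jacobiHeatDz_z`,
  `hasDerivAt_jacobiHeat_t`, continuity of the derivative series, `jacobiHeat_pde`;
* `exists_abs_jacobiHeat_le_near_zero`, `exists_bound_jacobiHeat`, `exists_bound_jacobiHeatDz`.

## References

* G. F. Lawler, O. Schramm, W. Werner, *One-arm exponent for critical 2D percolation*, Electron.
  J. Probab. 7 (2002), no. 2, Lemma 2.2. [LawlerSchrammWernerEJP2002]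
* G. E. Andrews, R. Askey, R. Roy, *Special Functions*, CUP (1999), (2.3.5). [AndrewsAskeyRoy1999]
-/

noncomputable section

open Polynomial Set Filter
open scoped Topology

namespace Literature.Analysis.SpecialFunctions

/-! ### Definitions -/

/-- The `n`-th term `γ_n e^{-μ n(n+1) t} y_n(z)` of the Jacobi heat series. [folklore] -/
def jacobiHeatTerm (c μ : ℝ) (γ : ℕ → ℝ) (n : ℕ) (z t : ℝ) : ℝ :=
  γ n * Real.exp (-(μ * n * (n + 1) * t)) * (hypJacobi c n).eval z

/-- **The Jacobi heat series** `Y(z, t) = Σ_n γ_n e^{-μ n(n+1) t} y_n(z)`. [folklore] -/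
def jacobiHeat (c μ : ℝ) (γ : ℕ → ℝ) (z t : ℝ) : ℝ :=
  ∑' n, jacobiHeatTerm c μ γ n z t

/-- The `n`-th term of the `z`-derivative series: `γ_n e^{-μ n(n+1) t} y_n'(z)`. [folklore] -/
def jacobiHeatTermDz (c μ : ℝ) (γ : ℕ → ℝ) (n : ℕ) (z t : ℝ) : ℝ :=
  γ n * Real.exp (-(μ * n * (n + 1) * t)) * (derivative (hypJacobi c n)).eval z

/-- The `n`-th term of the second `z`-derivative series: `γ_n e^{-μ n(n+1) t} y_n''(z)`.
[folklore] -/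
def jacobiHeatTermDzz (c μ : ℝ) (γ : ℕ → ℝ) (n : ℕ) (z t : ℝ) : ℝ :=
  γ n * Real.exp (-(μ * n * (n + 1) * t)) * (derivative (derivative (hypJacobi c n))).eval z

/-- The `n`-th term of the `t`-derivative series: `-μ n(n+1) γ_n e^{-μ n(n+1) t} y_n(z)`.
[folklore] -/
def jacobiHeatTermDt (c μ : ℝ) (γ : ℕ → ℝ) (n : ℕ) (z t : ℝ) : ℝ :=
  -(μ * n * (n + 1)) * jacobiHeatTerm c μ γ n z t

/-- The termwise `z`-derivative `∂_z Y = Σ_n γ_n e^{-μ n(n+1) t} y_n'(z)`. [folklore] -/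
def jacobiHeatDz (c μ : ℝ) (γ : ℕ → ℝ) (z t : ℝ) : ℝ := ∑' n, jacobiHeatTermDz c μ γ n z t

/-- The termwise second `z`-derivative `∂²_z Y`. [folklore] -/
def jacobiHeatDzz (c μ : ℝ) (γ : ℕ → ℝ) (z t : ℝ) : ℝ := ∑' n, jacobiHeatTermDzz c μ γ n z t

/-- The termwise `t`-derivative `∂ₜ Y`. [folklore] -/
def jacobiHeatDt (c μ : ℝ) (γ : ℕ → ℝ) (z t : ℝ) : ℝ := ∑' n, jacobiHeatTermDt c μ γ n z t

/-! ### Summability tools -/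

/-- `Σ_n (n+1)^p r^n` converges for `0 < r < 1`. [folklore] -/
theorem summable_pow_mul_geometric' (p : ℕ) {r : ℝ} (hr0 : 0 < r) (hr1 : r < 1) :
    Summable fun n : ℕ => ((n : ℝ) + 1) ^ p * r ^ n := by
  have h := summable_pow_mul_geometric_of_norm_lt_one p
    (show ‖r‖ < 1 by rwa [Real.norm_eq_abs, abs_of_pos hr0])
  have h2 := ((summable_nat_add_iff 1).2 h).mul_left r⁻¹
  refine h2.congr fun n => ?_
  push_cast
  field_simp
  ring

/-- `Σ_n C (n+1)^p (e^{-μ t₀})^n` converges (`μ, t₀ > 0`). [folklore] -/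
theorem summable_heat_bound {μ t₀ : ℝ} (hμ : 0 < μ) (ht₀ : 0 < t₀) (C : ℝ) (p : ℕ) :
    Summable fun n : ℕ => C * ((n : ℝ) + 1) ^ p * Real.exp (-(μ * t₀)) ^ n := by
  have hneg : -(μ * t₀) < 0 := by nlinarith [mul_pos hμ ht₀]
  have h := (summable_pow_mul_geometric' p (Real.exp_pos _)
    (Real.exp_lt_one_iff.2 hneg)).mul_left C
  refine h.congr fun n => ?_
  ring

/-- From `x² ≤ K m²` with `m ≥ 0` to `|x| ≤ √K · m`. [folklore] -/
theorem abs_le_sqrt_mul_of_sq_le {x K m : ℝ} (hm : 0 ≤ m) (h : x ^ 2 ≤ K * m ^ 2) :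
    |x| ≤ Real.sqrt K * m := by
  have := Real.abs_le_sqrt h
  rwa [Real.sqrt_mul' _ (sq_nonneg m), Real.sqrt_sq hm] at this

/-- The heat factor on `[t₀, ∞)`: `e^{-μ n(n+1) t} ≤ (e^{-μ t₀})^n` (`μ ≥ 0`, `t ≥ t₀ ≥ 0`).
[folklore] -/
theorem exp_heat_le {μ t₀ t : ℝ} (hμ : 0 ≤ μ) (ht₀ : 0 ≤ t₀) (ht : t₀ ≤ t) (n : ℕ) :
    Real.exp (-(μ * n * (n + 1) * t)) ≤ Real.exp (-(μ * t₀)) ^ n := by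
  rw [← Real.exp_nat_mul, Real.exp_le_exp]
  have hn : (0 : ℝ) ≤ n := n.cast_nonneg
  have h1 : (n : ℝ) * t₀ ≤ n * (n + 1) * t := by
    have h2 : (n : ℝ) * t₀ ≤ n * t := mul_le_mul_of_nonneg_left ht hn
    have h3 : 0 ≤ (n : ℝ) * n * t := mul_nonneg (mul_nonneg hn hn) (ht₀.trans ht)
    nlinarith
  have := mul_le_mul_of_nonneg_left h1 hμ
  nlinarith

/-- The heat factor is at most `1` (`μ, t ≥ 0`). [folklore] -/
theorem exp_heat_le_one {μ t : ℝ} (hμ : 0 ≤ μ) (ht : 0 ≤ t) (n : ℕ) :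
    Real.exp (-(μ * n * (n + 1) * t)) ≤ 1 := by
  rw [Real.exp_le_one_iff]
  have : 0 ≤ μ * n * (n + 1) * t := by positivity
  linarith

section Series

variable {c μ G : ℝ} {γ : ℕ → ℝ} (hc : 1 < c) (hc2 : c < 2) (hμ : 0 < μ)
  (hγ : ∀ n, γ n ^ 2 * hypJacobiNormSq c n ≤ G)
include hc hc2 hγ

/-- `G ≥ 0` (from `n = 0`: `h_0 > 0`). [folklore] -/
theorem jacobiHeat_G_nonneg : 0 ≤ G :=
  (mul_nonneg (sq_nonneg _) (hypJacobiNormSq_pos hc hc2 0).le).trans (hγ 0)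

/-- From a bound `f² ≤ K (n+1)^{2p} h_n` to `|γ_n f| ≤ √(K G) (n+1)^p`. [folklore] -/
theorem abs_coeff_mul_le {K f : ℝ} {p : ℕ} (n : ℕ)
    (hf : f ^ 2 ≤ K * ((n : ℝ) + 1) ^ (2 * p) * hypJacobiNormSq c n) :
    |γ n * f| ≤ Real.sqrt (K * G) * ((n : ℝ) + 1) ^ p := by
  refine abs_le_sqrt_mul_of_sq_le (by positivity) ?_
  have hKn : 0 ≤ K * ((n : ℝ) + 1) ^ (2 * p) := by
    by_contra hneg
    push Not at hneg
    have h1 : f ^ 2 ≤ K * ((n : ℝ) + 1) ^ (2 * p) * hypJacobiNormSq c n := hf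
    have h2 : K * ((n : ℝ) + 1) ^ (2 * p) * hypJacobiNormSq c n < 0 :=
      mul_neg_of_neg_of_pos hneg (hypJacobiNormSq_pos hc hc2 n)
    nlinarith [sq_nonneg f]
  calc (γ n * f) ^ 2 = γ n ^ 2 * f ^ 2 := by ring
    _ ≤ γ n ^ 2 * (K * ((n : ℝ) + 1) ^ (2 * p) * hypJacobiNormSq c n) :=
        mul_le_mul_of_nonneg_left hf (sq_nonneg _)
    _ = K * ((n : ℝ) + 1) ^ (2 * p) * (γ n ^ 2 * hypJacobiNormSq c n) := by ring
    _ ≤ K * ((n : ℝ) + 1) ^ (2 * p) * G := mul_le_mul_of_nonneg_left (hγ n) hKn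
    _ = K * G * (((n : ℝ) + 1) ^ p) ^ 2 := by ring

include hμ

/-- **Generic termwise bound**: if `f_n(z)² ≤ K (n+1)^{2p} h_n` then
`|γ_n e^{-μn(n+1)t} f_n(z)| ≤ √(KG) (n+1)^p (e^{-μ t₀})^n` for `t ≥ t₀ > 0`. [folklore] -/
theorem abs_term_le {t₀ : ℝ} (ht₀ : 0 < t₀) {K f : ℝ} {p : ℕ} (n : ℕ) {t : ℝ} (ht : t₀ ≤ t)
    (hf : f ^ 2 ≤ K * ((n : ℝ) + 1) ^ (2 * p) * hypJacobiNormSq c n) :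
    |γ n * Real.exp (-(μ * n * (n + 1) * t)) * f| ≤
      Real.sqrt (K * G) * ((n : ℝ) + 1) ^ p * Real.exp (-(μ * t₀)) ^ n := by
  have h1 := abs_coeff_mul_le hc hc2 hγ n hf
  have h2 := exp_heat_le hμ.le ht₀.le ht n
  have h3 : 0 ≤ Real.exp (-(μ * n * (n + 1) * t)) := (Real.exp_pos _).le
  rw [show γ n * Real.exp (-(μ * n * (n + 1) * t)) * f
    = (γ n * f) * Real.exp (-(μ * n * (n + 1) * t)) by ring, abs_mul, abs_of_nonneg h3]
  exact mul_le_mul h1 h2 h3 (by positivity)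

/-! ### The function `Y`: convergence and continuity -/

/-- Termwise bound for `Y` on `[a, 1] × [t₀, ∞)` with the constant of `exists_sq_hypJacobi_le`.
[folklore] -/
theorem abs_jacobiHeatTerm_le {a t₀ : ℝ} (ht₀ : 0 < t₀) {K : ℝ}
    (hsup : ∀ n : ℕ, ∀ z ∈ Icc a 1,
      ((hypJacobi c n).eval z) ^ 2 ≤ K * ((n : ℝ) + 1) ^ 2 * hypJacobiNormSq c n)
    (n : ℕ) {z t : ℝ} (hz : z ∈ Icc a 1) (ht : t₀ ≤ t) :
    |jacobiHeatTerm c μ γ n z t| ≤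
      Real.sqrt (K * G) * ((n : ℝ) + 1) ^ 1 * Real.exp (-(μ * t₀)) ^ n :=
  abs_term_le hc hc2 hμ hγ ht₀ n ht (p := 1) (by simpa using hsup n z hz)

/-- **Joint continuity on `[a, 1] × [t₀, ∞)`** (`0 < a < 1`, `t₀ > 0`; uniform convergence).
[folklore] -/
theorem continuousOn_jacobiHeat {a t₀ : ℝ} (ha : 0 < a) (ha1 : a < 1) (ht₀ : 0 < t₀) :
    ContinuousOn (fun p : ℝ × ℝ => jacobiHeat c μ γ p.1 p.2) (Icc a 1 ×ˢ Ici t₀) := by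
  obtain ⟨K, hK, hsup⟩ := exists_sq_hypJacobi_le hc hc2 ha ha1
  unfold jacobiHeat
  refine continuousOn_tsum (fun n => ?_) (summable_heat_bound hμ ht₀ (Real.sqrt (K * G)) 1)
    fun n p hp => ?_
  · unfold jacobiHeatTerm
    exact ((continuous_const.mul (Real.continuous_exp.comp (by fun_prop))).mul
      ((continuous_hypJacobi_eval c n).comp continuous_fst)).continuousOn
  · rw [Real.norm_eq_abs]
    exact abs_jacobiHeatTerm_le hc hc2 hμ hγ ht₀ hsup n hp.1 hp.2

omit hc hc2 hμ hγ in
/-- A neighbourhood basis fact: for `z ∈ (0, 1]`, `t > 0`, the box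
`[min(z/2, 1/2), 1] × [t/2, ∞)` is a neighbourhood of `(z, t)` within `(0, 1] × (0, ∞)`.
[folklore] -/
theorem box_mem_nhdsWithin {z t : ℝ} (hz : z ∈ Ioc (0 : ℝ) 1) (ht : 0 < t) :
    Icc (min (z / 2) (1 / 2)) 1 ×ˢ Ici (t / 2) ∈ 𝓝[Ioc 0 1 ×ˢ Ioi 0] (z, t) := by
  refine mem_nhdsWithin.2 ⟨Ioi (z / 2) ×ˢ Ioi (t / 2), isOpen_Ioi.prod isOpen_Ioi,
    ⟨by simp only [mem_Ioi]; linarith [hz.1], by simp only [mem_Ioi]; linarith⟩, ?_⟩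
  rintro ⟨z', t'⟩ ⟨⟨hz', ht'⟩, ⟨hz'', -⟩⟩
  simp only [mem_Ioi, mem_prod, mem_Icc, mem_Ici, mem_Ioc] at hz' ht' hz'' ⊢
  exact ⟨⟨(min_le_left _ _).trans hz'.le, hz''.2⟩, ht'.le⟩

omit hc hc2 hμ hγ in
/-- Local-to-global: a function continuous on every box `[a, 1] × [t₀, ∞)` (`0 < a < 1`, `t₀ > 0`)
is continuous on `(0, 1] × (0, ∞)`. [folklore] -/
theorem continuousOn_of_boxes {F : ℝ × ℝ → ℝ}
    (h : ∀ a t₀ : ℝ, 0 < a → a < 1 → 0 < t₀ → ContinuousOn F (Icc a 1 ×ˢ Ici t₀)) :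
    ContinuousOn F (Ioc 0 1 ×ˢ Ioi 0) := by
  rintro ⟨z, t⟩ ⟨hz, ht⟩
  have ha : 0 < min (z / 2) (1 / 2) := lt_min (by linarith [hz.1]) (by norm_num)
  have ha1 : min (z / 2) (1 / 2) < 1 := (min_le_right _ _).trans_lt (by norm_num)
  have hmem : (z, t) ∈ Icc (min (z / 2) (1 / 2)) 1 ×ˢ Ici (t / 2) :=
    ⟨⟨(min_le_left _ _).trans (by linarith [hz.1]), hz.2⟩, by
      simp only [mem_Ici]; linarith [mem_Ioi.1 ht]⟩
  exact ((h _ _ ha ha1 (half_pos ht)).continuousWithinAt hmem).mono_of_mem_nhdsWithin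
    (box_mem_nhdsWithin hz ht)

omit hc hc2 hμ hγ in
/-- Local-to-global, half-open boxes: continuity on every `[a, 1) × [t₀, ∞)` gives continuity on
`(0, 1) × (0, ∞)`. [folklore] -/
theorem continuousOn_of_boxes_Ico {F : ℝ × ℝ → ℝ}
    (h : ∀ a t₀ : ℝ, 0 < a → a < 1 → 0 < t₀ → ContinuousOn F (Ico a 1 ×ˢ Ici t₀)) :
    ContinuousOn F (Ioo 0 1 ×ˢ Ioi 0) := by
  rintro ⟨z, t⟩ ⟨hz, ht⟩
  have ha : 0 < z / 2 := by linarith [hz.1]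
  have ha1 : z / 2 < 1 := by linarith [hz.2]
  have hmem : (z, t) ∈ Ico (z / 2) 1 ×ˢ Ici (t / 2) :=
    ⟨⟨by linarith [hz.1], hz.2⟩, by simp only [mem_Ici]; linarith [mem_Ioi.1 ht]⟩
  refine ((h _ _ ha ha1 (half_pos ht)).continuousWithinAt hmem).mono_of_mem_nhdsWithin ?_
  refine mem_nhdsWithin.2 ⟨Ioi (z / 2) ×ˢ Ioi (t / 2), isOpen_Ioi.prod isOpen_Ioi,
    ⟨by simp only [mem_Ioi]; linarith [hz.1], by simp only [mem_Ioi]; linarith [mem_Ioi.1 ht]⟩,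
    ?_⟩
  rintro ⟨z', t'⟩ ⟨⟨hz', ht'⟩, ⟨hz'', -⟩⟩
  simp only [mem_Ioi, mem_prod, mem_Ico, mem_Ici, mem_Ioo] at hz' ht' hz'' ⊢
  exact ⟨⟨hz'.le, hz''.2⟩, ht'.le⟩

omit hc hc2 hμ hγ in
/-- Local-to-global, compact boxes: continuity on every `[a, b] × [t₀, ∞)` (`0 < a < b < 1`) gives
continuity on `(0, 1) × (0, ∞)`. [folklore] -/
theorem continuousOn_of_boxes_Icc {F : ℝ × ℝ → ℝ}
    (h : ∀ a b t₀ : ℝ, 0 < a → a < b → b < 1 → 0 < t₀ → ContinuousOn F (Icc a b ×ˢ Ici t₀)) :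
    ContinuousOn F (Ioo 0 1 ×ˢ Ioi 0) := by
  rintro ⟨z, t⟩ ⟨hz, ht⟩
  have ha : 0 < z / 2 := by linarith [hz.1]
  have hab : z / 2 < (z + 1) / 2 := by linarith
  have hb : (z + 1) / 2 < 1 := by linarith [hz.2]
  have hmem : (z, t) ∈ Icc (z / 2) ((z + 1) / 2) ×ˢ Ici (t / 2) :=
    ⟨⟨by linarith [hz.1], by linarith [hz.2]⟩, by simp only [mem_Ici]; linarith [mem_Ioi.1 ht]⟩
  refine ((h _ _ _ ha hab hb (half_pos ht)).continuousWithinAt hmem).mono_of_mem_nhdsWithin ?_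
  refine mem_nhdsWithin.2 ⟨Ioo (z / 2) ((z + 1) / 2) ×ˢ Ioi (t / 2), isOpen_Ioo.prod isOpen_Ioi,
    ⟨⟨by linarith [hz.1], by linarith [hz.2]⟩, by simp only [mem_Ioi]; linarith [mem_Ioi.1 ht]⟩,
    ?_⟩
  rintro ⟨z', t'⟩ ⟨⟨hz', ht'⟩, -⟩
  simp only [mem_Ioi, mem_prod, mem_Icc, mem_Ici, mem_Ioo] at hz' ht' ⊢
  exact ⟨⟨hz'.1.le, hz'.2.le⟩, ht'.le⟩

/-- **`Y` is continuous on `(0, 1] × (0, ∞)`.** [folklore] -/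
theorem continuousOn_jacobiHeat' :
    ContinuousOn (fun p : ℝ × ℝ => jacobiHeat c μ γ p.1 p.2) (Ioc 0 1 ×ˢ Ioi 0) :=
  continuousOn_of_boxes fun _ _ ha ha1 ht₀ => continuousOn_jacobiHeat hc hc2 hμ hγ ha ha1 ht₀

/-- **The series converges** at every `z ∈ (0, 1]`, `t > 0`. [folklore] -/
theorem summable_jacobiHeatTerm {z t : ℝ} (hz : z ∈ Ioc (0 : ℝ) 1) (ht : 0 < t) :
    Summable fun n => jacobiHeatTerm c μ γ n z t := by
  have ha : 0 < min (z / 2) (1 / 2) := lt_min (by linarith [hz.1]) (by norm_num)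
  have ha1 : min (z / 2) (1 / 2) < 1 := (min_le_right _ _).trans_lt (by norm_num)
  obtain ⟨K, hK, hsup⟩ := exists_sq_hypJacobi_le hc hc2 ha ha1
  refine Summable.of_norm_bounded (summable_heat_bound hμ ht (Real.sqrt (K * G)) 1) fun n => ?_
  rw [Real.norm_eq_abs]
  exact abs_jacobiHeatTerm_le hc hc2 hμ hγ ht hsup n
    ⟨(min_le_left _ _).trans (by linarith [hz.1]), hz.2⟩ le_rfl

/-- **Sup bound on `[a, 1] × [t₀, ∞)`**: `|Y| ≤ C`. [folklore] -/
theorem exists_bound_jacobiHeat {a t₀ : ℝ} (ha : 0 < a) (ha1 : a < 1) (ht₀ : 0 < t₀) :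
    ∃ C : ℝ, ∀ z ∈ Icc a 1, ∀ t, t₀ ≤ t → |jacobiHeat c μ γ z t| ≤ C := by
  obtain ⟨K, hK, hsup⟩ := exists_sq_hypJacobi_le hc hc2 ha ha1
  have hS := summable_heat_bound hμ ht₀ (Real.sqrt (K * G)) 1
  refine ⟨∑' n : ℕ, Real.sqrt (K * G) * ((n : ℝ) + 1) ^ 1 * Real.exp (-(μ * t₀)) ^ n,
    fun z hz t ht => ?_⟩
  have hb := fun n => abs_jacobiHeatTerm_le hc hc2 hμ hγ ht₀ hsup n hz ht
  have hsum : Summable fun n => jacobiHeatTerm c μ γ n z t :=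
    Summable.of_norm_bounded hS fun n => by rw [Real.norm_eq_abs]; exact hb n
  unfold jacobiHeat
  calc |∑' n, jacobiHeatTerm c μ γ n z t| ≤ ∑' n, |jacobiHeatTerm c μ γ n z t| := by
        have := norm_tsum_le_tsum_norm hsum.norm
        simpa only [Real.norm_eq_abs] using this
    _ ≤ _ := hsum.abs.tsum_le_tsum hb hS

/-! ### The `z`-derivatives -/

/-- Termwise bound for `∂_z Y` on `[a, 1) × [t₀, ∞)` with the constant of
`exists_sq_derivative_hypJacobi_le`. [folklore] -/
theorem abs_jacobiHeatTermDz_le {a t₀ : ℝ} (ht₀ : 0 < t₀) {K : ℝ}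
    (hder : ∀ n : ℕ, ∀ z ∈ Ico a 1,
      ((derivative (hypJacobi c n)).eval z) ^ 2 ≤ K * ((n : ℝ) + 1) ^ 6 * hypJacobiNormSq c n)
    (n : ℕ) {z t : ℝ} (hz : z ∈ Ico a 1) (ht : t₀ ≤ t) :
    |jacobiHeatTermDz c μ γ n z t| ≤
      Real.sqrt (K * G) * ((n : ℝ) + 1) ^ 3 * Real.exp (-(μ * t₀)) ^ n :=
  abs_term_le hc hc2 hμ hγ ht₀ n ht (p := 3) (by simpa using hder n z hz)

/-- Termwise bound for `∂²_z Y` on `[a, b] × [t₀, ∞)` with the constant of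
`exists_sq_derivative_derivative_hypJacobi_le`. [folklore] -/
theorem abs_jacobiHeatTermDzz_le {a b t₀ : ℝ} (ht₀ : 0 < t₀) {K : ℝ}
    (hder : ∀ n : ℕ, ∀ z ∈ Icc a b, ((derivative (derivative (hypJacobi c n))).eval z) ^ 2 ≤
      K * ((n : ℝ) + 1) ^ 6 * hypJacobiNormSq c n)
    (n : ℕ) {z t : ℝ} (hz : z ∈ Icc a b) (ht : t₀ ≤ t) :
    |jacobiHeatTermDzz c μ γ n z t| ≤
      Real.sqrt (K * G) * ((n : ℝ) + 1) ^ 3 * Real.exp (-(μ * t₀)) ^ n :=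
  abs_term_le hc hc2 hμ hγ ht₀ n ht (p := 3) (by simpa using hder n z hz)

/-- **`∂_z Y` exists and equals the termwise derivative** at every `z ∈ (0, 1)`, `t > 0`.
[folklore] -/
theorem hasDerivAt_jacobiHeat_z {z t : ℝ} (hz : z ∈ Ioo (0 : ℝ) 1) (ht : 0 < t) :
    HasDerivAt (fun x => jacobiHeat c μ γ x t) (jacobiHeatDz c μ γ z t) z := by
  have ha : 0 < z / 2 := by linarith [hz.1]
  have ha1 : z / 2 < 1 := by linarith [hz.2]
  obtain ⟨K, hK, hder⟩ := exists_sq_derivative_hypJacobi_le hc hc2 ha ha1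
  have hzmem : z ∈ Ioo (z / 2) 1 := ⟨by linarith [hz.1], hz.2⟩
  unfold jacobiHeat jacobiHeatDz
  refine hasDerivAt_tsum_of_isPreconnected (g := fun n x => jacobiHeatTerm c μ γ n x t)
    (g' := fun n x => jacobiHeatTermDz c μ γ n x t)
    (summable_heat_bound hμ ht (Real.sqrt (K * G)) 3)
    isOpen_Ioo isPreconnected_Ioo (fun n y _ => ?_) (fun n y hy => ?_) hzmem
    (summable_jacobiHeatTerm hc hc2 hμ hγ ⟨hz.1, hz.2.le⟩ ht) hzmem
  · unfold jacobiHeatTerm jacobiHeatTermDz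
    exact ((hasDerivAt_hypJacobi_eval c n y).const_mul _)
  · rw [Real.norm_eq_abs]
    exact abs_jacobiHeatTermDz_le hc hc2 hμ hγ ht hder n ⟨hy.1.le, hy.2⟩ le_rfl

/-- The `z`-derivative series converges on `(0, 1) × (0, ∞)`. [folklore] -/
theorem summable_jacobiHeatTermDz {z t : ℝ} (hz : z ∈ Ioo (0 : ℝ) 1) (ht : 0 < t) :
    Summable fun n => jacobiHeatTermDz c μ γ n z t := by
  have ha : 0 < z / 2 := by linarith [hz.1]
  have ha1 : z / 2 < 1 := by linarith [hz.2]
  obtain ⟨K, hK, hder⟩ := exists_sq_derivative_hypJacobi_le hc hc2 ha ha1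
  refine Summable.of_norm_bounded (summable_heat_bound hμ ht (Real.sqrt (K * G)) 3) fun n => ?_
  rw [Real.norm_eq_abs]
  exact abs_jacobiHeatTermDz_le hc hc2 hμ hγ ht hder n ⟨by linarith [hz.1], hz.2⟩ le_rfl

/-- **`∂²_z Y` exists and equals the termwise second derivative** at every `z ∈ (0, 1)`, `t > 0`.
[folklore] -/
theorem hasDerivAt_jacobiHeatDz_z {z t : ℝ} (hz : z ∈ Ioo (0 : ℝ) 1) (ht : 0 < t) :
    HasDerivAt (fun x => jacobiHeatDz c μ γ x t) (jacobiHeatDzz c μ γ z t) z := by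
  have ha : 0 < z / 2 := by linarith [hz.1]
  set b := (z + 1) / 2 with hb
  have hab : z / 2 < b := by rw [hb]; linarith [hz.1]
  have hb1 : b < 1 := by rw [hb]; linarith [hz.2]
  obtain ⟨K, hK, hder⟩ := exists_sq_derivative_derivative_hypJacobi_le hc hc2 ha hab hb1
  have hzmem : z ∈ Ioo (z / 2) b := ⟨by linarith [hz.1], by rw [hb]; linarith [hz.2]⟩
  unfold jacobiHeatDz jacobiHeatDzz
  refine hasDerivAt_tsum_of_isPreconnected (g := fun n x => jacobiHeatTermDz c μ γ n x t)
    (g' := fun n x => jacobiHeatTermDzz c μ γ n x t)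
    (summable_heat_bound hμ ht (Real.sqrt (K * G)) 3)
    isOpen_Ioo isPreconnected_Ioo (fun n y _ => ?_) (fun n y hy => ?_) hzmem
    (summable_jacobiHeatTermDz hc hc2 hμ hγ hz ht) hzmem
  · unfold jacobiHeatTermDz jacobiHeatTermDzz
    exact ((hasDerivAt_derivative_hypJacobi_eval c n y).const_mul _)
  · rw [Real.norm_eq_abs]
    exact abs_jacobiHeatTermDzz_le hc hc2 hμ hγ ht hder n ⟨hy.1.le, hy.2.le⟩ le_rfl

/-- The second `z`-derivative series converges on `(0, 1) × (0, ∞)`. [folklore] -/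
theorem summable_jacobiHeatTermDzz {z t : ℝ} (hz : z ∈ Ioo (0 : ℝ) 1) (ht : 0 < t) :
    Summable fun n => jacobiHeatTermDzz c μ γ n z t := by
  have ha : 0 < z / 2 := by linarith [hz.1]
  have hab : z / 2 < z := by linarith [hz.1]
  obtain ⟨K, hK, hder⟩ := exists_sq_derivative_derivative_hypJacobi_le hc hc2 ha hab hz.2
  refine Summable.of_norm_bounded (summable_heat_bound hμ ht (Real.sqrt (K * G)) 3) fun n => ?_
  rw [Real.norm_eq_abs]
  exact abs_jacobiHeatTermDzz_le hc hc2 hμ hγ ht hder n ⟨hab.le, le_rfl⟩ le_rfl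

/-- **`∂_z Y` is continuous on `[a, 1) × [t₀, ∞)`** (`0 < a < 1`, `t₀ > 0`). [folklore] -/
theorem continuousOn_jacobiHeatDz {a t₀ : ℝ} (ha : 0 < a) (ha1 : a < 1) (ht₀ : 0 < t₀) :
    ContinuousOn (fun p : ℝ × ℝ => jacobiHeatDz c μ γ p.1 p.2) (Ico a 1 ×ˢ Ici t₀) := by
  obtain ⟨K, hK, hder⟩ := exists_sq_derivative_hypJacobi_le hc hc2 ha ha1
  unfold jacobiHeatDz
  refine continuousOn_tsum (fun n => ?_) (summable_heat_bound hμ ht₀ (Real.sqrt (K * G)) 3)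
    fun n p hp => ?_
  · unfold jacobiHeatTermDz
    exact ((continuous_const.mul (Real.continuous_exp.comp (by fun_prop))).mul
      ((Polynomial.differentiable _).continuous.comp continuous_fst)).continuousOn
  · rw [Real.norm_eq_abs]
    exact abs_jacobiHeatTermDz_le hc hc2 hμ hγ ht₀ hder n hp.1 hp.2

/-- **`∂²_z Y` is continuous on `[a, b] × [t₀, ∞)`** (`0 < a < b < 1`, `t₀ > 0`). [folklore] -/
theorem continuousOn_jacobiHeatDzz {a b t₀ : ℝ} (ha : 0 < a) (hab : a < b) (hb : b < 1)
    (ht₀ : 0 < t₀) :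
    ContinuousOn (fun p : ℝ × ℝ => jacobiHeatDzz c μ γ p.1 p.2) (Icc a b ×ˢ Ici t₀) := by
  obtain ⟨K, hK, hder⟩ := exists_sq_derivative_derivative_hypJacobi_le hc hc2 ha hab hb
  unfold jacobiHeatDzz
  refine continuousOn_tsum (fun n => ?_) (summable_heat_bound hμ ht₀ (Real.sqrt (K * G)) 3)
    fun n p hp => ?_
  · unfold jacobiHeatTermDzz
    exact ((continuous_const.mul (Real.continuous_exp.comp (by fun_prop))).mul
      ((Polynomial.differentiable _).continuous.comp continuous_fst)).continuousOn
  · rw [Real.norm_eq_abs]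
    exact abs_jacobiHeatTermDzz_le hc hc2 hμ hγ ht₀ hder n hp.1 hp.2

/-- **`∂_z Y` is continuous on `(0, 1) × (0, ∞)`.** [folklore] -/
theorem continuousOn_jacobiHeatDz' :
    ContinuousOn (fun p : ℝ × ℝ => jacobiHeatDz c μ γ p.1 p.2) (Ioo 0 1 ×ˢ Ioi 0) :=
  continuousOn_of_boxes_Ico fun _ _ ha ha1 ht₀ => continuousOn_jacobiHeatDz hc hc2 hμ hγ ha ha1 ht₀

/-- **`∂²_z Y` is continuous on `(0, 1) × (0, ∞)`.** [folklore] -/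
theorem continuousOn_jacobiHeatDzz' :
    ContinuousOn (fun p : ℝ × ℝ => jacobiHeatDzz c μ γ p.1 p.2) (Ioo 0 1 ×ˢ Ioi 0) :=
  continuousOn_of_boxes_Icc fun _ _ _ ha hab hb ht₀ =>
    continuousOn_jacobiHeatDzz hc hc2 hμ hγ ha hab hb ht₀

/-- **Sup bound for `∂_z Y` on `[a, 1) × [t₀, ∞)`**: `|∂_z Y| ≤ C` (bounded up to `z = 1`).
[folklore] -/
theorem exists_bound_jacobiHeatDz {a t₀ : ℝ} (ha : 0 < a) (ha1 : a < 1) (ht₀ : 0 < t₀) :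
    ∃ C : ℝ, ∀ z ∈ Ico a 1, ∀ t, t₀ ≤ t → |jacobiHeatDz c μ γ z t| ≤ C := by
  obtain ⟨K, hK, hder⟩ := exists_sq_derivative_hypJacobi_le hc hc2 ha ha1
  have hS := summable_heat_bound hμ ht₀ (Real.sqrt (K * G)) 3
  refine ⟨∑' n : ℕ, Real.sqrt (K * G) * ((n : ℝ) + 1) ^ 3 * Real.exp (-(μ * t₀)) ^ n,
    fun z hz t ht => ?_⟩
  have hb := fun n => abs_jacobiHeatTermDz_le hc hc2 hμ hγ ht₀ hder n hz ht
  have hsum : Summable fun n => jacobiHeatTermDz c μ γ n z t :=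
    Summable.of_norm_bounded hS fun n => by rw [Real.norm_eq_abs]; exact hb n
  unfold jacobiHeatDz
  calc |∑' n, jacobiHeatTermDz c μ γ n z t| ≤ ∑' n, |jacobiHeatTermDz c μ γ n z t| := by
        have := norm_tsum_le_tsum_norm hsum.norm
        simpa only [Real.norm_eq_abs] using this
    _ ≤ _ := hsum.abs.tsum_le_tsum hb hS

/-! ### The `t`-derivative and the heat equation -/

/-- Termwise bound for `∂ₜ Y` on `[a, 1] × [t₀, ∞)`. [folklore] -/
theorem abs_jacobiHeatTermDt_le {a t₀ : ℝ} (ht₀ : 0 < t₀) {K : ℝ}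
    (hsup : ∀ n : ℕ, ∀ z ∈ Icc a 1,
      ((hypJacobi c n).eval z) ^ 2 ≤ K * ((n : ℝ) + 1) ^ 2 * hypJacobiNormSq c n)
    (n : ℕ) {z t : ℝ} (hz : z ∈ Icc a 1) (ht : t₀ ≤ t) :
    |jacobiHeatTermDt c μ γ n z t| ≤
      μ * Real.sqrt (K * G) * ((n : ℝ) + 1) ^ 3 * Real.exp (-(μ * t₀)) ^ n := by
  have h := abs_jacobiHeatTerm_le hc hc2 hμ hγ ht₀ hsup n hz ht
  rw [pow_one] at h
  rw [jacobiHeatTermDt, abs_mul, abs_neg, abs_of_nonneg (by positivity : (0:ℝ) ≤ μ * n * (n + 1))]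
  have hn : (n : ℝ) * (n + 1) ≤ ((n : ℝ) + 1) ^ 2 := by nlinarith [n.cast_nonneg (α := ℝ)]
  calc μ * n * (n + 1) * |jacobiHeatTerm c μ γ n z t|
        ≤ μ * ((n : ℝ) + 1) ^ 2 * (Real.sqrt (K * G) * ((n : ℝ) + 1) * Real.exp (-(μ * t₀)) ^ n) := by
          rw [mul_assoc μ]
          exact mul_le_mul (mul_le_mul_of_nonneg_left hn hμ.le) h (abs_nonneg _) (by positivity)
    _ = μ * Real.sqrt (K * G) * ((n : ℝ) + 1) ^ 3 * Real.exp (-(μ * t₀)) ^ n := by ring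

/-- **`∂ₜ Y` exists and equals the termwise derivative** at every `z ∈ (0, 1]`, `t > 0`.
[folklore] -/
theorem hasDerivAt_jacobiHeat_t {z t : ℝ} (hz : z ∈ Ioc (0 : ℝ) 1) (ht : 0 < t) :
    HasDerivAt (fun s => jacobiHeat c μ γ z s) (jacobiHeatDt c μ γ z t) t := by
  have ha : 0 < min (z / 2) (1 / 2) := lt_min (by linarith [hz.1]) (by norm_num)
  have ha1 : min (z / 2) (1 / 2) < 1 := (min_le_right _ _).trans_lt (by norm_num)
  have hzmem : z ∈ Icc (min (z / 2) (1 / 2)) 1 := ⟨(min_le_left _ _).trans (by linarith [hz.1]), hz.2⟩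
  obtain ⟨K, hK, hsup⟩ := exists_sq_hypJacobi_le hc hc2 ha ha1
  have ht2 : 0 < t / 2 := half_pos ht
  have htmem : t ∈ Ioi (t / 2) := by simp only [mem_Ioi]; linarith
  unfold jacobiHeat jacobiHeatDt
  refine hasDerivAt_tsum_of_isPreconnected (g := fun n s => jacobiHeatTerm c μ γ n z s)
    (g' := fun n s => jacobiHeatTermDt c μ γ n z s)
    (summable_heat_bound hμ ht2 (μ * Real.sqrt (K * G)) 3) isOpen_Ioi
    isPreconnected_Ioi (fun n s _ => ?_) (fun n s hs => ?_) htmem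
    (summable_jacobiHeatTerm hc hc2 hμ hγ hz ht) htmem
  · unfold jacobiHeatTermDt jacobiHeatTerm
    have h1 : HasDerivAt (fun s : ℝ => -(μ * n * (n + 1) * s)) (-(μ * n * (n + 1))) s :=
      (((hasDerivAt_id s).const_mul (μ * n * (n + 1))).neg).congr_deriv (by simp)
    exact ((h1.exp.const_mul (γ n)).mul_const ((hypJacobi c n).eval z)).congr_deriv (by ring)
  · rw [Real.norm_eq_abs]
    exact abs_jacobiHeatTermDt_le hc hc2 hμ hγ ht2 hsup n hzmem (le_of_lt hs)

/-- The `t`-derivative series converges on `(0, 1] × (0, ∞)`. [folklore] -/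
theorem summable_jacobiHeatTermDt {z t : ℝ} (hz : z ∈ Ioc (0 : ℝ) 1) (ht : 0 < t) :
    Summable fun n => jacobiHeatTermDt c μ γ n z t := by
  have ha : 0 < min (z / 2) (1 / 2) := lt_min (by linarith [hz.1]) (by norm_num)
  have ha1 : min (z / 2) (1 / 2) < 1 := (min_le_right _ _).trans_lt (by norm_num)
  obtain ⟨K, hK, hsup⟩ := exists_sq_hypJacobi_le hc hc2 ha ha1
  refine Summable.of_norm_bounded (summable_heat_bound hμ ht (μ * Real.sqrt (K * G)) 3)
    fun n => ?_
  rw [Real.norm_eq_abs]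
  exact abs_jacobiHeatTermDt_le hc hc2 hμ hγ ht hsup n
    ⟨(min_le_left _ _).trans (by linarith [hz.1]), hz.2⟩ le_rfl

/-- **`∂ₜ Y` is continuous on `[a, 1] × [t₀, ∞)`.** [folklore] -/
theorem continuousOn_jacobiHeatDt {a t₀ : ℝ} (ha : 0 < a) (ha1 : a < 1) (ht₀ : 0 < t₀) :
    ContinuousOn (fun p : ℝ × ℝ => jacobiHeatDt c μ γ p.1 p.2) (Icc a 1 ×ˢ Ici t₀) := by
  obtain ⟨K, hK, hsup⟩ := exists_sq_hypJacobi_le hc hc2 ha ha1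
  unfold jacobiHeatDt
  refine continuousOn_tsum (fun n => ?_)
    (summable_heat_bound hμ ht₀ (μ * Real.sqrt (K * G)) 3) fun n p hp => ?_
  · unfold jacobiHeatTermDt jacobiHeatTerm
    exact (continuous_const.mul ((continuous_const.mul (Real.continuous_exp.comp (by fun_prop))).mul
      ((continuous_hypJacobi_eval c n).comp continuous_fst))).continuousOn
  · rw [Real.norm_eq_abs]
    exact abs_jacobiHeatTermDt_le hc hc2 hμ hγ ht₀ hsup n hp.1 hp.2

/-- **`∂ₜ Y` is continuous on `(0, 1] × (0, ∞)`.** [folklore] -/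
theorem continuousOn_jacobiHeatDt' :
    ContinuousOn (fun p : ℝ × ℝ => jacobiHeatDt c μ γ p.1 p.2) (Ioc 0 1 ×ˢ Ioi 0) :=
  continuousOn_of_boxes fun _ _ ha ha1 ht₀ => continuousOn_jacobiHeatDt hc hc2 hμ hγ ha ha1 ht₀

/-- **The Jacobi heat equation**: `∂ₜ Y = μ [z(1-z) ∂²_z Y + (c - 2z) ∂_z Y]` on
`(0, 1) × (0, ∞)`, with the termwise derivatives (Euler's equation termwise). [folklore] -/
theorem jacobiHeat_pde {z t : ℝ} (hz : z ∈ Ioo (0 : ℝ) 1) (ht : 0 < t) :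
    jacobiHeatDt c μ γ z t =
      μ * (z * (1 - z) * jacobiHeatDzz c μ γ z t + (c - 2 * z) * jacobiHeatDz c μ γ z t) := by
  have hck : ∀ n : ℕ, ∀ k : ℕ, k < n → (k : ℝ) + c ≠ 0 := fun n k _ => by positivity
  have h1 := summable_jacobiHeatTermDz hc hc2 hμ hγ hz ht
  have h2 := summable_jacobiHeatTermDzz hc hc2 hμ hγ hz ht
  have hterm : ∀ n, jacobiHeatTermDt c μ γ n z t =
      μ * (z * (1 - z)) * jacobiHeatTermDzz c μ γ n z t
        + μ * (c - 2 * z) * jacobiHeatTermDz c μ γ n z t := by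
    intro n
    have hode := hypJacobi_ode_eval n (hck n) z
    unfold jacobiHeatTermDt jacobiHeatTerm jacobiHeatTermDzz jacobiHeatTermDz
    linear_combination (-(μ * γ n * Real.exp (-(μ * n * (n + 1) * t)))) * hode
  unfold jacobiHeatDt jacobiHeatDzz jacobiHeatDz
  rw [tsum_congr hterm, Summable.tsum_add (h2.mul_left _) (h1.mul_left _), tsum_mul_left,
    tsum_mul_left]
  ring

/-! ### Behaviour near `z = 0` -/

/-- **Bound near `z = 0`**: for `t₀ > 0` there is `C` with `|Y(z, t)| ≤ C z^{(1-c)/2}` for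
`z ∈ (0, 1/2]`, `t ≥ t₀`; hence `z^{(c-1)} Y(z,t) → 0` as `z → 0⁺`, uniformly in `t ≥ t₀`.
[folklore] -/
theorem exists_abs_jacobiHeat_le_near_zero {t₀ : ℝ} (ht₀ : 0 < t₀) :
    ∃ C : ℝ, 0 ≤ C ∧ ∀ z ∈ Ioc (0 : ℝ) (1 / 2), ∀ t, t₀ ≤ t →
      |jacobiHeat c μ γ z t| ≤ C * z ^ ((1 - c) / 2) := by
  obtain ⟨K, hK, hnz⟩ := exists_sq_hypJacobi_le_near_zero hc hc2
  have hS := summable_heat_bound hμ ht₀ (Real.sqrt (K * G)) 1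
  set C := ∑' n : ℕ, Real.sqrt (K * G) * ((n : ℝ) + 1) ^ 1 * Real.exp (-(μ * t₀)) ^ n with hC
  have hC0 : 0 ≤ C := tsum_nonneg fun n => by positivity
  refine ⟨C, hC0, fun z hz t ht => ?_⟩
  have hzpow : 0 < z ^ ((1 - c) / 2) := Real.rpow_pos_of_pos hz.1 _
  -- termwise: `|term| ≤ √(KG) (n+1) r^n · z^{(1-c)/2}`
  have hb : ∀ n, |jacobiHeatTerm c μ γ n z t| ≤
      (Real.sqrt (K * G) * ((n : ℝ) + 1) ^ 1 * Real.exp (-(μ * t₀)) ^ n) * z ^ ((1 - c) / 2) := by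
    intro n
    have hsq : ((hypJacobi c n).eval z) ^ 2 ≤
        (K * z ^ (1 - c)) * ((n : ℝ) + 1) ^ (2 * 1) * hypJacobiNormSq c n :=
      (hnz n z hz).trans_eq (by ring)
    have h := abs_term_le hc hc2 hμ hγ ht₀ n ht (p := 1) hsq
    have hKG : 0 ≤ K * G := by have := jacobiHeat_G_nonneg hc hc2 hγ; positivity
    have hsqrt : Real.sqrt (K * z ^ (1 - c) * G) = Real.sqrt (K * G) * z ^ ((1 - c) / 2) := by
      rw [show K * z ^ (1 - c) * G = (K * G) * z ^ (1 - c) by ring, Real.sqrt_mul hKG,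
        Real.sqrt_eq_rpow (z ^ (1 - c)), ← Real.rpow_mul hz.1.le,
        show (1 - c) * (1 / 2) = (1 - c) / 2 by ring]
    rw [jacobiHeatTerm]
    calc _ ≤ Real.sqrt (K * z ^ (1 - c) * G) * ((n : ℝ) + 1) ^ 1 * Real.exp (-(μ * t₀)) ^ n := h
      _ = _ := by rw [hsqrt]; ring
  have hsum : Summable fun n => jacobiHeatTerm c μ γ n z t :=
    Summable.of_norm_bounded (hS.mul_right _) fun n => by rw [Real.norm_eq_abs]; exact hb n
  unfold jacobiHeat
  calc |∑' n, jacobiHeatTerm c μ γ n z t| ≤ ∑' n, |jacobiHeatTerm c μ γ n z t| := by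
        have := norm_tsum_le_tsum_norm hsum.norm
        simpa only [Real.norm_eq_abs] using this
    _ ≤ ∑' n : ℕ, (Real.sqrt (K * G) * ((n : ℝ) + 1) ^ 1 * Real.exp (-(μ * t₀)) ^ n)
          * z ^ ((1 - c) / 2) := hsum.abs.tsum_le_tsum hb (hS.mul_right _)
    _ = C * z ^ ((1 - c) / 2) := by rw [tsum_mul_right]

end Series

end Literature.Analysis.SpecialFunctions
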